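import Summits.ResolutionOfSingularities.ResolutionOfSingularities.Theorems.FrobeniusClosingPatchingRelPerfectMonomialPairStep
import HarnessLib

/-!
# Crux `PatchingRelPerfect` (stmt-ResolutionOfSingularities-16161), chain w52 — R4 support:
# PRINCIPALIZATION OF MONOMIAL IDEALS (finite sums of monomials), part 1 (bookkeeping)

[OURS · L1 W5.2 · R4 support «monomial cleanup»] From the pair (`…MonomialPair{Bookkeeping,Step,
Principalization}.lean`) to an ARBITRARY monomial ideal `Σ_i monomialIdeal (𝓐 i)` of a simple normal
crossings boundary (`𝓐 : Fin r → List (X.IdealSheafData × ℕ)`, all on one boundary list `Es`): the pair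
theorem is run pair by pair, and what makes this work is that **comparabilities already achieved
survive every blowing up of a stratum** (Goward's monotonicity remark, here for honest blow-ups of
strata): `badPairs_transformExp_eq_empty`.  This file PROVES the bookkeeping:

* `weightOf_le_weightOf_of_forall_expOf_le`; **`badPairs_transformExp_eq_empty`** — if `(D₁, D₂)` has
  no bad pair, neither has the pair of transformed lists `transformExp Dᵢ π T 0` along the blowing up of
  ANY stratum `T` of the boundary (at a common point `x'` of two new divisors all old divisors behind
  them, and all of `T` if the exceptional divisor is involved, pass through `π x'`, where `D₁`, `D₂`
  compare uniformly);
* `stalkIdeal_monomialIdeal_le_or_ge` — no bad pair ⇒ the two stalks are comparable at every point;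
  **`isLocallyPrincipal_finsetSup_of_forall_badPairs_eq_empty`** — a finite family of exponent lists
  with pairwise no bad pairs has locally principal sum (a finite chain of stalk ideals has a greatest
  member);
* the family measure: `badIndexPairs 𝓐` / `numBad 𝓐` (index pairs with a bad pair), non-increasing
  under any stratum blow-up (`badIndexPairs_transformExp_subset`), `pairSupports 𝓐` (the union of the
  pairwise cosupports, where all centres will lie) and the conclusion predicate
  `AdmitsFamilyPrincipalization 𝓐`.

The step and the induction are `…MonomialFamilyPrincipalization.lean`.  Fact-free, any dimension;
nothing here is a statement of the manuscript under review.

## References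

* R. Goward, *A simple algorithm for principalization of monomial ideals*, Trans. AMS 357 (2005),
  §2. [Goward2005]
* J. Kollár, *Lectures on Resolution of Singularities* (2007), (3.111) Step 3. [Kollar2007]
-/

-- `Summit.<Summit>.<Sub>.Theorems` with `Sub = Summit` (single-conjunct summit, D-0017)
set_option linter.dupNamespace false

noncomputable section

open CategoryTheory AlgebraicGeometry TopologicalSpace IsLocalRing
open Literature.AlgebraicGeometry.Resolution

namespace Summit.ResolutionOfSingularities.ResolutionOfSingularities.Theorems

namespace MonomialCleanup

universe u

/-! ## Weights compare when exponents do -/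

/-- If `a_K ≤ b_K` for every `K ∈ T` then `∑_T a ≤ ∑_T b`. [folklore] -/
theorem weightOf_le_weightOf_of_forall_expOf_le {X : Scheme.{u}} {D₁ D₂ : List (X.IdealSheafData × ℕ)}
    {T : Finset X.IdealSheafData} (h : ∀ K ∈ T, expOf D₁ K ≤ expOf D₂ K) :
    weightOf D₁ T ≤ weightOf D₂ T := by
  classical
  induction T using Finset.induction_on with
  | empty => simp
  | insert K T hK ih =>
    rw [weightOf_insert D₁ hK, weightOf_insert D₂ hK]
    exact Nat.add_le_add (h K (Finset.mem_insert_self K T))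
      (ih fun L hL => h L (Finset.mem_insert_of_mem hL))

/-! ## No bad pair: uniform comparison at a point -/

/-- With no bad pair, at every point `x` either `a_K ≤ b_K` for all divisors `K ∋ x` or `b_K ≤ a_K`
for all of them. [folklore] -/
theorem forall_expOf_le_or_ge_of_badPairs_eq_empty {X : Scheme.{u}} {A B : List (X.IdealSheafData × ℕ)}
    (hAB : boundaryOf A = boundaryOf B) (h : badPairs A B = ∅) (x : X) :
    (∀ K ∈ sheaves A, x ∈ K.support → expOf A K ≤ expOf B K) ∨
      (∀ K ∈ sheaves A, x ∈ K.support → expOf B K ≤ expOf A K) := by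
  by_cases hA : ∀ K ∈ sheaves A, x ∈ K.support → expOf A K ≤ expOf B K
  · exact Or.inl hA
  · right
    push Not at hA
    obtain ⟨K, hK, hxK, hlt⟩ := hA
    intro L hL hxL
    by_contra hlt'
    have hmem : (K, L) ∈ badPairs A B :=
      mem_badPairs_iff.mpr ⟨hK, (sheaves_eq_of_boundaryOf_eq hAB) ▸ hL, hlt, lt_of_not_ge hlt', x, hxK, hxL⟩
    rw [h] at hmem
    exact absurd hmem (Finset.notMem_empty _)

/-- With no bad pair, the stalks of the two monomial ideals are comparable at every point. [folklore] -/
theorem stalkIdeal_monomialIdeal_le_or_ge {X : Scheme.{u}} {A B : List (X.IdealSheafData × ℕ)}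
    (hAB : boundaryOf A = boundaryOf B) (h : badPairs A B = ∅) (x : X) :
    stalkIdeal (monomialIdeal B) x ≤ stalkIdeal (monomialIdeal A) x ∨
      stalkIdeal (monomialIdeal A) x ≤ stalkIdeal (monomialIdeal B) x := by
  rcases forall_expOf_le_or_ge_of_badPairs_eq_empty hAB h x with hle | hge
  · exact Or.inl (stalkIdeal_monomialIdeal_le_of_forall_expOf_le hAB x hle)
  · refine Or.inr (stalkIdeal_monomialIdeal_le_of_forall_expOf_le hAB.symm x fun K hK hxK => ?_)
    exact hge K ((sheaves_eq_of_boundaryOf_eq hAB).symm ▸ hK) hxK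

/-! ## Comparability persists under the blowing up of any stratum -/

section Persistence

variable {X X' : Scheme.{u}} [IsLocallyNoetherian X] {π : X' ⟶ X} {T : Finset X.IdealSheafData}
  {D₁ D₂ : List (X.IdealSheafData × ℕ)}

/-- **Comparabilities survive stratum blow-ups.** If `(D₁, D₂)` has no bad pair then, after blowing
up the stratum of ANY set `T` of boundary divisors, the transformed exponent lists have no bad pair: at a
common point `x'` of two new divisors, the old divisors behind them — and all of `T`, if the exceptional
divisor is one of them — pass through `π x'`, where `D₁`, `D₂` compare uniformly, and the exceptional
exponents are the sums over `T`. [cite: Goward2005, §2] -/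
theorem badPairs_transformExp_eq_empty (hE : HasSNC (boundaryOf D₁)) (h12 : boundaryOf D₁ = boundaryOf D₂)
    (hT : ∀ K ∈ T, K ∈ boundaryOf D₁) (hπ : IsBlowup π (T.sup id)) (h : badPairs D₁ D₂ = ∅) :
    badPairs (transformExp D₁ π T 0) (transformExp D₂ π T 0) = ∅ := by
  classical
  have hE2 : HasSNC (boundaryOf D₂) := h12 ▸ hE
  have hT2 : ∀ K ∈ T, K ∈ boundaryOf D₂ := fun K hK => h12 ▸ hT K hK
  have hS : sheaves D₁ = sheaves D₂ := sheaves_eq_of_boundaryOf_eq h12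
  refine Finset.eq_empty_iff_forall_notMem.mpr fun p' hp' => ?_
  obtain ⟨hG, hH, hGlt, hHlt, x', hxG, hxH⟩ := mem_badPairs_iff.mp hp'
  obtain ⟨G, H⟩ := p'
  simp only at hG hH hGlt hHlt hxG hxH
  set F : X'.IdealSheafData := (T.sup id).comap π with hFdef
  -- all of `T` passes through `π x'` as soon as `x'` lies on the exceptional divisor
  have hTthrough : x' ∈ F.support → ∀ K ∈ T, π x' ∈ K.support := by
    intro hxF K hK
    have h' : x' ∈ (F.support : Set X') := hxF
    rw [hFdef, Scheme.IdealSheafData.support_comap] at h'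
    exact (mem_support_finsetSup_iff T _).mp h' K hK
  rcases forall_expOf_le_or_ge_of_badPairs_eq_empty h12 h (π x') with hle | hge
  · -- `D₁ ≤ D₂` at `π x'`: contradiction with `G` being `D₁`-heavy after the blow-up
    rcases eq_comap_or_exists_eq_strictTransform hG hxG with hGF | ⟨G₀, hG₀, hG₀eq, hxG₀⟩
    · rw [hGF] at hGlt hxG
      rw [expOf_transformExp_comap hE hT hπ hxG, expOf_transformExp_comap hE2 hT2 hπ hxG,
        Nat.sub_zero, Nat.sub_zero] at hGlt
      have hw := weightOf_le_weightOf_of_forall_expOf_le (D₁ := D₁) (D₂ := D₂) (T := T)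
        fun K hK => hle K (mem_sheaves_iff.mpr (hT K hK)) (hTthrough hxG K hK)
      omega
    · rw [← hG₀eq] at hGlt hxG
      rw [expOf_transformExp_strictTransform hE hT hπ hG₀ hxG,
        expOf_transformExp_strictTransform hE2 hT2 hπ (hS ▸ hG₀) hxG] at hGlt
      have := hle G₀ hG₀ hxG₀
      omega
  · -- `D₂ ≤ D₁` at `π x'`: contradiction with `H` being `D₂`-heavy after the blow-up
    rcases eq_comap_or_exists_eq_strictTransform hH hxH with hHF | ⟨H₀, hH₀, hH₀eq, hxH₀⟩
    · rw [hHF] at hHlt hxH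
      rw [expOf_transformExp_comap hE hT hπ hxH, expOf_transformExp_comap hE2 hT2 hπ hxH,
        Nat.sub_zero, Nat.sub_zero] at hHlt
      have hw := weightOf_le_weightOf_of_forall_expOf_le (D₁ := D₂) (D₂ := D₁) (T := T)
        fun K hK => hge K (mem_sheaves_iff.mpr (hT K hK)) (hTthrough hxH K hK)
      omega
    · rw [← hH₀eq] at hHlt hxH
      rw [expOf_transformExp_strictTransform hE hT hπ (hS.symm ▸ hH₀) hxH,
        expOf_transformExp_strictTransform hE2 hT2 hπ hH₀ hxH] at hHlt
      have := hge H₀ (hS.symm ▸ hH₀) hxH₀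
      omega

end Persistence

/-! ## Families of exponent lists on one boundary -/

section Family

variable {X : Scheme.{u}} {r : ℕ}

/-- The index pairs `(i, j)` such that `(𝓐 i, 𝓐 j)` has a bad pair. [folklore] -/
def badIndexPairs (𝓐 : Fin r → List (X.IdealSheafData × ℕ)) : Finset (Fin r × Fin r) := by
  classical exact Finset.univ.filter fun p => (badPairs (𝓐 p.1) (𝓐 p.2)).Nonempty

/-- Membership in `badIndexPairs`. [folklore] -/
theorem mem_badIndexPairs_iff {𝓐 : Fin r → List (X.IdealSheafData × ℕ)} {p : Fin r × Fin r} :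
    p ∈ badIndexPairs 𝓐 ↔ (badPairs (𝓐 p.1) (𝓐 p.2)).Nonempty := by
  classical
  simp only [badIndexPairs, Finset.mem_filter, Finset.mem_univ, true_and]

/-- **The number of incomparable index pairs** — the outer termination measure. [folklore] -/
def numBad (𝓐 : Fin r → List (X.IdealSheafData × ℕ)) : ℕ :=
  (badIndexPairs 𝓐).card

/-- No incomparable index pair iff every pair of members has no bad pair. [folklore] -/
theorem numBad_eq_zero_iff {𝓐 : Fin r → List (X.IdealSheafData × ℕ)} :
    numBad 𝓐 = 0 ↔ ∀ i j, badPairs (𝓐 i) (𝓐 j) = ∅ := by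
  rw [numBad, Finset.card_eq_zero, Finset.eq_empty_iff_forall_notMem]
  constructor
  · intro h i j
    by_contra hne
    exact h (i, j) (mem_badIndexPairs_iff.mpr (Finset.nonempty_iff_ne_empty.mpr hne))
  · intro h p hp
    exact (Finset.nonempty_iff_ne_empty.mp (mem_badIndexPairs_iff.mp hp)) (h p.1 p.2)

/-- **The union of the pairwise cosupports** `⋃_{i ≠ j} V(monomialIdeal (𝓐 i) + monomialIdeal (𝓐 j))`:
every centre of the family principalization lies here. [folklore] -/
def pairSupports (𝓐 : Fin r → List (X.IdealSheafData × ℕ)) : Set X :=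
  ⋃ p : {p : Fin r × Fin r // p.1 ≠ p.2},
    ((monomialIdeal (𝓐 p.1.1) ⊔ monomialIdeal (𝓐 p.1.2)).support : Set X)

/-- A pairwise cosupport lies in `pairSupports`. [folklore] -/
theorem support_sup_subset_pairSupports (𝓐 : Fin r → List (X.IdealSheafData × ℕ)) {i j : Fin r}
    (hij : i ≠ j) :
    ((monomialIdeal (𝓐 i) ⊔ monomialIdeal (𝓐 j)).support : Set X) ⊆ pairSupports 𝓐 :=
  Set.subset_iUnion (fun p : {p : Fin r × Fin r // p.1 ≠ p.2} =>
    ((monomialIdeal (𝓐 p.1.1) ⊔ monomialIdeal (𝓐 p.1.2)).support : Set X)) ⟨(i, j), hij⟩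

/-- A list with itself has no bad pair. [folklore] -/
theorem badPairs_self (A : List (X.IdealSheafData × ℕ)) : badPairs A A = ∅ := by
  refine Finset.eq_empty_iff_forall_notMem.mpr fun p hp => ?_
  obtain ⟨-, -, h1, -, -⟩ := mem_badPairs_iff.mp hp
  exact absurd h1 (lt_irrefl _)

/-- [OURS · L1 W5.2] **`𝓐` admits a principalization by strata** (family version of
`AdmitsStratumPrincipalization`): a `CentreSeq` with regular centres inside `pairSupports 𝓐`, a simple
normal crossings boundary `Es'` on its last scheme carrying transformed exponent lists `𝓐' i` with
`π^*(monomialIdeal (𝓐 i)) = monomialIdeal (𝓐' i)`, PAIRWISE WITHOUT BAD PAIRS (hence with locally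
principal sum, `isLocallyPrincipal_finsetSup_of_forall_badPairs_eq_empty`). [folklore] -/
def AdmitsFamilyPrincipalization (𝓐 : Fin r → List (X.IdealSheafData × ℕ)) : Prop :=
  ∃ (s : CentreSeq X) (Es' : List s.top.IdealSheafData) (𝓐' : Fin r → List (s.top.IdealSheafData × ℕ)),
    s.AllRegular ∧ s.CentresOver (pairSupports 𝓐) ∧ HasSNC Es' ∧ (∀ i, boundaryOf (𝓐' i) = Es') ∧
    (∀ i, (monomialIdeal (𝓐 i)).comap s.comp = monomialIdeal (𝓐' i)) ∧
    ∀ i j, badPairs (𝓐' i) (𝓐' j) = ∅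

end Family

/-! ## The family after one stratum blow-up -/

section FamilyStep

variable {X X' : Scheme.{u}} [IsLocallyNoetherian X] {π : X' ⟶ X} {T : Finset X.IdealSheafData}
  {r : ℕ} {Es : List X.IdealSheafData} {𝓐 : Fin r → List (X.IdealSheafData × ℕ)}

/-- Incomparable index pairs after a stratum blow-up were incomparable before. [cite: Goward2005, §2] -/
theorem badIndexPairs_transformExp_subset (hEs : HasSNC Es) (hb : ∀ i, boundaryOf (𝓐 i) = Es)
    (hT : ∀ K ∈ T, K ∈ Es) (hπ : IsBlowup π (T.sup id)) :
    badIndexPairs (fun i => transformExp (𝓐 i) π T 0) ⊆ badIndexPairs 𝓐 := by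
  intro p hp
  rw [mem_badIndexPairs_iff] at hp ⊢
  by_contra hemp
  rw [Finset.not_nonempty_iff_eq_empty] at hemp
  have h := badPairs_transformExp_eq_empty (D₁ := 𝓐 p.1) (D₂ := 𝓐 p.2) ((hb p.1).symm ▸ hEs)
    ((hb p.1).trans (hb p.2).symm) (fun K hK => (hb p.1).symm ▸ hT K hK) hπ hemp
  exact hp.ne_empty h

/-- Hence `numBad` does not increase … [folklore] -/
theorem numBad_transformExp_le (hEs : HasSNC Es) (hb : ∀ i, boundaryOf (𝓐 i) = Es)
    (hT : ∀ K ∈ T, K ∈ Es) (hπ : IsBlowup π (T.sup id)) :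
    numBad (fun i => transformExp (𝓐 i) π T 0) ≤ numBad 𝓐 :=
  Finset.card_le_card (badIndexPairs_transformExp_subset hEs hb hT hπ)

/-- … and drops when some incomparable index pair becomes comparable. [folklore] -/
theorem numBad_transformExp_lt (hEs : HasSNC Es) (hb : ∀ i, boundaryOf (𝓐 i) = Es)
    (hT : ∀ K ∈ T, K ∈ Es) (hπ : IsBlowup π (T.sup id)) {i j : Fin r}
    (hij : (badPairs (𝓐 i) (𝓐 j)).Nonempty)
    (hij' : badPairs (transformExp (𝓐 i) π T 0) (transformExp (𝓐 j) π T 0) = ∅) :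
    numBad (fun i => transformExp (𝓐 i) π T 0) < numBad 𝓐 := by
  refine Finset.card_lt_card ⟨badIndexPairs_transformExp_subset hEs hb hT hπ, fun h => ?_⟩
  have hmem : (i, j) ∈ badIndexPairs 𝓐 := mem_badIndexPairs_iff.mpr hij
  have hmem' := mem_badIndexPairs_iff.mp (h hmem)
  exact hmem'.ne_empty hij'

omit [IsLocallyNoetherian X] in
/-- The common boundary after the blow-up. [folklore] -/
theorem boundaryOf_transformExp_eq (hb : ∀ i, boundaryOf (𝓐 i) = Es) (i : Fin r) :
    boundaryOf (transformExp (𝓐 i) π T 0) =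
      Es.map (strictTransformIdeal π (T.sup id)) ++ [(T.sup id).comap π] := by
  rw [boundaryOf_transformExp, hb i]

/-- The pairwise cosupports after the blow-up lie over those before. [folklore] -/
theorem pairSupports_transformExp_subset (hEs : HasSNC Es) (hb : ∀ i, boundaryOf (𝓐 i) = Es)
    (hT : ∀ K ∈ T, K ∈ Es) (hπ : IsBlowup π (T.sup id)) :
    pairSupports (fun i => transformExp (𝓐 i) π T 0) ⊆ π ⁻¹' pairSupports 𝓐 := by
  intro x' hx'
  obtain ⟨p, hp⟩ := Set.mem_iUnion.mp hx'
  have hcomap : (monomialIdeal (𝓐 p.1.1) ⊔ monomialIdeal (𝓐 p.1.2)).comap π =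
      monomialIdeal (transformExp (𝓐 p.1.1) π T 0) ⊔ monomialIdeal (transformExp (𝓐 p.1.2) π T 0) := by
    rw [Scheme.IdealSheafData.comap_sup,
      comap_monomialIdeal_eq_transformExp ((hb p.1.1).symm ▸ hEs) (fun K hK => (hb p.1.1).symm ▸ hT K hK) hπ,
      comap_monomialIdeal_eq_transformExp ((hb p.1.2).symm ▸ hEs) (fun K hK => (hb p.1.2).symm ▸ hT K hK) hπ]
  have h1 : x' ∈ (((monomialIdeal (𝓐 p.1.1) ⊔ monomialIdeal (𝓐 p.1.2)).comap π).support : Set X') := by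
    rw [hcomap]; exact hp
  rw [Scheme.IdealSheafData.support_comap] at h1
  exact Set.mem_iUnion.mpr ⟨p, h1⟩

end FamilyStep

/-! ## Pairwise comparable families have locally principal sum -/

section Principal

variable {X : Scheme.{u}} {r : ℕ}

/-- Stalks of the zero ideal sheaf vanish. [folklore] -/
private theorem stalkIdeal_bot' (x : X) : stalkIdeal (⊥ : X.IdealSheafData) x = ⊥ := by
  obtain ⟨U, hU, hxU, -⟩ := exists_isAffineOpen_mem_and_subset (X := X) (x := x) (U := ⊤)
    (Opens.mem_top _)
  rw [stalkIdeal_eq_map_germ ⊥ ⟨U, hU⟩ hxU, Scheme.IdealSheafData.ideal_bot, Pi.bot_apply,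
    Ideal.map_bot]

/-- Stalks commute with finite suprema of ideal sheaves. [folklore] -/
theorem stalkIdeal_finsetSup' {ι : Type*} (s : Finset ι) (f : ι → X.IdealSheafData) (x : X) :
    stalkIdeal (s.sup f) x = s.sup fun i => stalkIdeal (f i) x := by
  classical
  induction s using Finset.induction_on with
  | empty => rw [Finset.sup_empty, Finset.sup_empty, stalkIdeal_bot']
  | insert a s ha ih => rw [Finset.sup_insert, Finset.sup_insert, stalkIdeal_sup, ih]

/-- A finite family of ideals, pairwise comparable, has a greatest member (or is empty).
[folklore] -/
theorem exists_forall_le_of_pairwise_comparable {R : Type*} [CommSemiring R] {ι : Type*}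
    (s : Finset ι) (J : ι → Ideal R) (h : ∀ i ∈ s, ∀ j ∈ s, J i ≤ J j ∨ J j ≤ J i) :
    s.sup J = ⊥ ∨ ∃ i ∈ s, s.sup J = J i := by
  classical
  induction s using Finset.induction_on with
  | empty => exact Or.inl (Finset.sup_empty)
  | insert a s ha ih =>
    right
    have h' : ∀ i ∈ s, ∀ j ∈ s, J i ≤ J j ∨ J j ≤ J i := fun i hi j hj =>
      h i (Finset.mem_insert_of_mem hi) j (Finset.mem_insert_of_mem hj)
    rcases ih h' with hbot | ⟨i₀, hi₀, heq⟩
    · exact ⟨a, Finset.mem_insert_self a s, by rw [Finset.sup_insert, hbot, sup_bot_eq]⟩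
    · rcases h a (Finset.mem_insert_self a s) i₀ (Finset.mem_insert_of_mem hi₀) with hle | hge
      · exact ⟨i₀, Finset.mem_insert_of_mem hi₀, by rw [Finset.sup_insert, heq, sup_eq_right.mpr hle]⟩
      · exact ⟨a, Finset.mem_insert_self a s, by rw [Finset.sup_insert, heq, sup_eq_left.mpr hge]⟩

/-- **A pairwise comparable family of monomial ideals has locally principal sum**: at each point the
stalks form a finite chain, whose greatest member — a principal monomial stalk — is the stalk of the
sum. [folklore] -/
theorem isLocallyPrincipal_finsetSup_of_forall_badPairs_eq_empty [IsLocallyNoetherian X]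
    {Es : List X.IdealSheafData} (hEs : HasSNC Es) {𝓐 : Fin r → List (X.IdealSheafData × ℕ)}
    (hb : ∀ i, boundaryOf (𝓐 i) = Es) (h : ∀ i j, badPairs (𝓐 i) (𝓐 j) = ∅) :
    IsLocallyPrincipal ((Finset.univ : Finset (Fin r)).sup fun i => monomialIdeal (𝓐 i)) := by
  intro x
  haveI : IsRegularLocalRing (X.presheaf.stalk x) := (hEs x).1
  refine isLocallyPrincipalAt_of_isPrincipal_stalkIdeal ?_
  rw [stalkIdeal_finsetSup']
  have hcomp : ∀ i ∈ (Finset.univ : Finset (Fin r)), ∀ j ∈ (Finset.univ : Finset (Fin r)),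
      stalkIdeal (monomialIdeal (𝓐 i)) x ≤ stalkIdeal (monomialIdeal (𝓐 j)) x ∨
        stalkIdeal (monomialIdeal (𝓐 j)) x ≤ stalkIdeal (monomialIdeal (𝓐 i)) x := fun i _ j _ =>
    (stalkIdeal_monomialIdeal_le_or_ge ((hb j).trans (hb i).symm) (h j i) x).symm.imp id id |>.symm
  rcases exists_forall_le_of_pairwise_comparable _ _ hcomp with hbot | ⟨i₀, -, heq⟩
  · rw [hbot]; exact ⟨0, by simp⟩
  · rw [heq]
    obtain ⟨g, hg, -, -⟩ := exists_generator_stalkIdeal_monomialIdeal (𝓐 i₀) (x := x) fun p hp hx =>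
      hEs.exists_generator_of_mem ((hb i₀) ▸ fst_mem_boundaryOf hp) hx
    exact ⟨g, hg⟩

end Principal

end MonomialCleanup

end Summit.ResolutionOfSingularities.ResolutionOfSingularities.Theorems

end
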